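import Literature.AlgebraicGeometry.Resolution.ChowLemmaRing
import Literature.AlgebraicGeometry.Limits.SubalgebraDiagram
import Literature.AlgebraicGeometry.Limits.EventuallyInsideOpen
import Literature.AlgebraicGeometry.Morphisms.UniversallyClosedCover
import Mathlib.AlgebraicGeometry.IdealSheaf.IrreducibleComponent
import HarnessLib

/-!
# Eventual properness of the stage images of a proper closed subscheme of `M ×_K Spec B`

Topic: `Literature/AlgebraicGeometry/Morphisms` (Noetherian approximation of proper schemes; The Stacks
Project, Tags 081F, 09ZR, 0A0Q; EGA IV₃ 8.10.5 (xii)). Let `K` be a Noetherian ring, `M → Spec K`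
separated of finite type, `B` a `K`-algebra, and `jY : Y ↪ M ×_K Spec B` a closed immersion with
`Y → Spec B` proper. Write `B = ⋃_t K[t]` (`t ⊆ B` finite; `Limits/SubalgebraDiagram`), so that
`M ×_K Spec B = lim_t M ×_K Spec K[t]` (`SubalgApprox.prodCone`), and let `Y'_t ⊆ M ×_K Spec K[t]` be
the scheme-theoretic image of `Y`. **Then `Y'_t → Spec K[t]` is proper for all large `t`**
(`exists_forall_isProper_stageImage`).

Proof (a variant of the proof of Tag 09ZR which descends no morphism and needs no finite
presentation): by Chow's lemma over `K` (`Resolution.ChowLemmaRing.chow`, on the integral closed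
subschemes carried by the irreducible components of the Noetherian scheme `M`) there are finitely many
proper `ρ_k : N_k → M` whose images cover `M` and immersions `e_k : N_k → ℙ_k = ℙ^{n_k}_K` over `K`.
The closed subscheme `W_k = Y ×_{M_B} N_{k,B}` of `N_{k,B}` is proper over `B`, so its image `𝒲_k` in
`ℙ_{k,B}` is closed. By `Limits.exists_closure_image_subset_preimage` (Tag 01Z3) the closures `F_{k,t}`
of the images of `𝒲_k` in the `ℙ_{k,t} = ℙ_k ×_K Spec K[t]` eventually lie in the pull-back of the open
`coborder (range e_{k,t₀})`, hence in `coborder (range e_{k,t})`, so that `F_{k,t} ∩ range e_{k,t}` is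
closed in `ℙ_{k,t}`; the closed subscheme `W'_{k,t}` it carries is proper over `K[t]`, and so is
`W''_{k,t} = W'_{k,t} ×_{ℙ_{k,t}} N_{k,t}` (a closed subscheme of both), which maps to `M_t` through
`ρ_{k,t}`. The images of these proper `K[t]`-schemes are closed and cover the image of `Y` in `M_t`
(chase a point of `Y` back to some `W_k`), hence cover `Y'_t`; so `Y'_t → Spec K[t]`, separated and of
finite type, is proper (`isProper_of_finite_cover`, Tag 03GN).

Everything is proved; no named facts.

## References

* The Stacks Project, Tags 081F, 09ZR, 0A0Q (Limits of Schemes), 02O2 (Chow's lemma), 01Z3, 03GN.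
  [StacksProject]
* A. Grothendieck, J. Dieudonné, EGA IV₃ (1966), Thm. 8.10.5; EGA II 5.6.1 (Chow).
* U. Görtz, T. Wedhorn, *Algebraic Geometry I*, 2nd ed. (2020), Thm. 13.100, (10.13). [GortzWedhorn2020]
-/

noncomputable section

universe u

open CategoryTheory CategoryTheory.Limits AlgebraicGeometry TopologicalSpace Opposite MonoidalCategory
open Literature.AlgebraicGeometry.Limits
open Literature.AlgebraicGeometry.Motives (SchemeOver specOver)

namespace Literature.AlgebraicGeometry.Morphisms

namespace StageImages

open Scheme.IdealSheafData

set_option backward.isDefEq.respectTransparency false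

/-! ## Base change of morphisms of `K`-schemes along `– ⊗ T` -/

section Whisker

variable {K : Type u} [CommRing K] {X X' : SchemeOver K} (f : X ⟶ X') {T T' : SchemeOver K} (u : T' ⟶ T)

/-- **`(f ▷ T).left` is a base change of `f.left`** (along the first projection `(X' ⊗ T).left → X'.left`).
[folklore] -/
theorem isPullback_whiskerRight_left (T : SchemeOver K) :
    IsPullback (f ▷ T).left (pullback.fst X.hom T.hom) (pullback.fst X'.hom T.hom) f.left := by
  refine IsPullback.of_right ?_ (Over.whiskerRight_left_fst f) (IsPullback.of_hasPullback X'.hom T.hom).flip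
  rw [Over.whiskerRight_left_snd, Over.w f]
  exact (IsPullback.of_hasPullback X.hom T.hom).flip

/-- **The square `(f ▷ T', X ◁ u, X' ◁ u, f ▷ T)` is cartesian.** [folklore] -/
theorem isPullback_whiskerRight_whiskerLeft :
    IsPullback (f ▷ T').left (X ◁ u).left (X' ◁ u).left (f ▷ T).left := by
  refine IsPullback.of_right ?_ ?_ (SubalgApprox.isPullback_whiskerLeft_left X' u).flip
  · rw [Over.whiskerRight_left_snd, Over.whiskerRight_left_snd]
    exact (SubalgApprox.isPullback_whiskerLeft_left X u).flip
  · rw [← Over.comp_left, ← Over.comp_left, whisker_exchange]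

/-- Naturality: `(f ▷ T') ≫ (X' ◁ u) = (X ◁ u) ≫ (f ▷ T)` on underlying schemes. [folklore] -/
@[reassoc]
theorem whiskerRight_left_whiskerLeft_left :
    (f ▷ T').left ≫ (X' ◁ u).left = (X ◁ u).left ≫ (f ▷ T).left := by
  rw [← Over.comp_left, ← Over.comp_left, whisker_exchange]

/-- The image of `(f ▷ T').left` is the preimage of the image of `(f ▷ T).left` (the square is cartesian;
Mathlib `Scheme.Pullback.range_fst` transported along `IsPullback.isoPullback`, as in the tree's
`Limits.range_fst_of_isPullback`). [folklore] -/
theorem range_whiskerRight_left :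
    Set.range (f ▷ T').left = (X' ◁ u).left ⁻¹' Set.range (f ▷ T).left := by
  have H := isPullback_whiskerRight_whiskerLeft f u
  rw [← H.isoPullback_hom_fst, Scheme.Hom.comp_base, TopCat.coe_comp, Set.range_comp,
    show Set.range ⇑H.isoPullback.hom = Set.univ from
      Set.range_eq_univ.mpr H.isoPullback.hom.homeomorph.surjective, Set.image_univ]
  exact Scheme.Pullback.range_fst _ _

/-- `(f ▷ T).left` is a closed immersion if `f.left` is. [folklore] -/
theorem isClosedImmersion_whiskerRight_left [IsClosedImmersion f.left] (T : SchemeOver K) :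
    IsClosedImmersion (f ▷ T).left :=
  MorphismProperty.of_isPullback (P := @IsClosedImmersion) (isPullback_whiskerRight_left f T).flip inferInstance

/-- `(f ▷ T).left` is an immersion if `f.left` is. [folklore] -/
theorem isImmersion_whiskerRight_left [IsImmersion f.left] (T : SchemeOver K) : IsImmersion (f ▷ T).left :=
  MorphismProperty.of_isPullback (P := @IsImmersion) (isPullback_whiskerRight_left f T).flip inferInstance

/-- `(f ▷ T).left` is proper if `f.left` is. [folklore] -/
theorem isProper_whiskerRight_left [IsProper f.left] (T : SchemeOver K) : IsProper (f ▷ T).left :=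
  MorphismProperty.of_isPullback (P := @IsProper) (isPullback_whiskerRight_left f T).flip inferInstance

/-- A point of `(X' ⊗ T).left` in the image of `f.left` (after projection) is in the image of
`(f ▷ T).left`. [folklore] -/
theorem mem_range_whiskerRight_left (T : SchemeOver K) {x : ↥(X' ⊗ T).left}
    (hx : pullback.fst X'.hom T.hom x ∈ Set.range f.left) : x ∈ Set.range (f ▷ T).left := by
  have H := isPullback_whiskerRight_left f T
  rw [← H.isoPullback_hom_fst, Scheme.Hom.comp_base, TopCat.coe_comp, Set.range_comp,
    show Set.range ⇑H.isoPullback.hom = Set.univ from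
      Set.range_eq_univ.mpr H.isoPullback.hom.homeomorph.surjective, Set.image_univ,
    Scheme.Pullback.range_fst]
  exact hx

end Whisker

/-! ## Chow pieces of a separated scheme of finite type over a Noetherian ring -/

section Chow

variable {K : Type u} [CommRing K] [IsNoetherianRing K] (M : SchemeOver K)
  [IsSeparated M.hom] [QuasiCompact M.hom] [LocallyOfFiniteType M.hom]

/-- **Chow pieces.** For `M → Spec K` separated of finite type over a Noetherian ring there are finitely
many `K`-schemes `N_k` with proper `K`-morphisms `ρ_k : N_k → M` whose images cover `M` and
`K`-immersions `e_k : N_k → ℙ^{n_k}_K` (Chow's lemma, `Resolution.ChowLemmaRing.chow`, applied to the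
integral closed subschemes carried by the finitely many irreducible components of `M`).
[cite: StacksProject, Tag 02O2 (Cohomology of Schemes, Chow's lemma)] [cite: GortzWedhorn2020, Thm 13.100] -/
theorem exists_chowPieces :
    ∃ (ι : Type u) (_ : Finite ι) (n : ι → ℕ) (N : ι → SchemeOver K) (ρ : ∀ k, N k ⟶ M)
      (e : ∀ k, N k ⟶ Resolution.ChowLemmaRing.projOver K (n k)),
      (∀ k, IsProper (ρ k).left) ∧ (∀ k, IsImmersion (e k).left) ∧
        ∀ x : M.left, ∃ k, x ∈ Set.range (ρ k).left := by
  classical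
  haveI : IsLocallyNoetherian M.left := LocallyOfFiniteType.isLocallyNoetherian M.hom
  haveI : CompactSpace M.left := QuasiCompact.compactSpace_of_compactSpace M.hom
  haveI : IsNoetherian M.left := ⟨⟩
  let ι : Type u := ↥(irreducibleComponents (M.left : Type u))
  haveI : Finite ι := (TopologicalSpace.NoetherianSpace.finite_irreducibleComponents (α := M.left)).to_subtype
  -- the integral closed subschemes on the components (reduced: the affine pieces are spectra of
  -- quotients by radical ideals; irreducible: the space is the component; as in the tree's
  -- `Resolution.isIntegral_subscheme_vanishingIdeal`)
  let Z : ι → Closeds M.left := fun k => ⟨k.1, isClosed_of_mem_irreducibleComponents k.1 k.2⟩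
  have hZ : ∀ k, IsIntegral (vanishingIdeal (Z k)).subscheme := fun k => by
    haveI : IrreducibleSpace (vanishingIdeal (Z k)).subscheme := by
      have e : ((vanishingIdeal (Z k)).support : Set M.left) = Z k := coe_support_vanishingIdeal (Z k)
      have : IsIrreducible ((vanishingIdeal (Z k)).support : Set M.left) := by rw [e]; exact k.2.1
      exact Subtype.irreducibleSpace this
    haveI : IsReduced (vanishingIdeal (Z k)).subscheme := by
      haveI : ∀ U, IsReduced ((vanishingIdeal (Z k)).subschemeCover.openCover.X U) := by
        intro (U : M.left.affineOpens)
        change IsReduced (Spec (.of (Γ(M.left, (U : M.left.Opens)) ⧸ (vanishingIdeal (Z k)).ideal U)))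
        haveI : _root_.IsReduced (Γ(M.left, (U : M.left.Opens)) ⧸ (vanishingIdeal (Z k)).ideal U) := by
          rw [← Ideal.isRadical_iff_quotient_reduced, vanishingIdeal_ideal]
          exact PrimeSpectrum.isRadical_vanishingIdeal _
        infer_instance
      exact IsReduced.of_openCover _ (vanishingIdeal (Z k)).subschemeCover.openCover
    exact isIntegral_of_irreducibleSpace_of_isReduced _
  have hchow : ∀ k : ι, ∃ (n : ℕ) (X' : Scheme.{u}) (π : X' ⟶ (vanishingIdeal (Z k)).subscheme)
      (e : X' ⟶ (Resolution.ChowLemmaRing.projOver K n).left),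
      IsImmersion e ∧ IsProper π ∧ Surjective π ∧
        e ≫ (Resolution.ChowLemmaRing.projOver K n).hom = π ≫ (vanishingIdeal (Z k)).subschemeι ≫ M.hom := by
    intro k
    haveI := hZ k
    obtain ⟨n, X', π, e, -, he, hπ, hsurj, hcomp, -⟩ :=
      Resolution.ChowLemmaRing.chow (R := K) (vanishingIdeal (Z k)).subscheme ((vanishingIdeal (Z k)).subschemeι ≫ M.hom)
    exact ⟨n, X', π, e, he, hπ, hsurj, hcomp⟩
  choose n X' π e he hπ hsurj hcomp using hchow
  refine ⟨ι, inferInstance, n, fun k => Over.mk (e k ≫ (Resolution.ChowLemmaRing.projOver K (n k)).hom),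
    fun k => Over.homMk (π k ≫ (vanishingIdeal (Z k)).subschemeι) (by rw [Category.assoc]; exact (hcomp k).symm),
    fun k => Over.homMk (e k) rfl, fun k => ?_, fun k => ?_, fun x => ?_⟩
  · change IsProper (π k ≫ (vanishingIdeal (Z k)).subschemeι)
    haveI := hπ k
    infer_instance
  · exact he k
  · -- `x` lies on some irreducible component
    let k : ι := ⟨irreducibleComponent x, irreducibleComponent_mem_irreducibleComponents x⟩
    have hx : x ∈ ((vanishingIdeal (Z k)).support : Set M.left) := by
      rw [coe_support_vanishingIdeal]; exact mem_irreducibleComponent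
    rw [← range_subschemeι] at hx
    obtain ⟨z, hz⟩ := hx
    haveI := hsurj k
    obtain ⟨w, hw⟩ := (π k).surjective z
    refine ⟨k, w, ?_⟩
    change (π k ≫ (vanishingIdeal (Z k)).subschemeι) w = x
    rw [Scheme.Hom.comp_apply, hw, hz]

end Chow

/-! ## Eventual properness of the stage images -/

section Main

variable {K B : Type u} [CommRing K] [IsNoetherianRing K] [CommRing B] [Algebra K B]
  (M : SchemeOver K) [IsSeparated M.hom] [QuasiCompact M.hom] [LocallyOfFiniteType M.hom]
  {Y : Scheme.{u}} (jY : Y ⟶ (M ⊗ specOver K B).left) [IsClosedImmersion jY]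
  [hY : IsProper (jY ≫ pullback.snd M.hom (specOver K B).hom)]

/-- A closed set contained in the coborder of `s` meets `s` in a closed set. [folklore] -/
theorem isClosed_inter_of_subset_coborder {X : Type*} [TopologicalSpace X] {C s : Set X} (hC : IsClosed C)
    (hCs : C ⊆ coborder s) : IsClosed (C ∩ s) := by
  have e : C ∩ s = C ∩ closure s := by
    conv_lhs => rw [← coborder_inter_closure (s := s)]
    rw [← Set.inter_assoc, Set.inter_eq_left.mpr hCs]
  rw [e]
  exact hC.inter isClosed_closure

include hY in
/-- **The stage images of a proper closed subscheme of `M ×_K Spec B` are eventually proper** (see the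
module docstring). With `π_t : M ×_K Spec B → M ×_K Spec K[t]` the stage maps and `Y'_t` the
scheme-theoretic image of `Y` in `M ×_K Spec K[t]`: there is `t₁` with `Y'_t → Spec K[t]` proper for all
`t ⊇ t₁`. [cite: StacksProject, Tag 09ZR (Limits of Schemes, Lemma lemma-proper-limit-of-proper-finite-presentation), properness step, via Tags 02O2, 01Z3, 03GN] -/
theorem exists_forall_isProper_stageImage :
    ∃ i₁ : (SubalgApprox.Idx B (∅ : Finset B))ᵒᵖ, ∀ (j : (SubalgApprox.Idx B (∅ : Finset B))ᵒᵖ) (_ : j ⟶ i₁),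
      IsProper ((jY ≫ (SubalgApprox.prodCone K B ∅ M).π.app j).ker.subschemeι ≫
        pullback.snd M.hom ((SubalgApprox.baseDiagram K B ∅).obj j).hom) := by
  classical
  obtain ⟨ι, hι, n, N, ρ, e, hρ, he, hcov⟩ := exists_chowPieces M
  haveI := hι
  haveI : ∀ k, IsProper (ρ k).left := hρ
  haveI : ∀ k, IsImmersion (e k).left := he
  -- notation
  let TB : SchemeOver K := specOver K B
  let Ts : (SubalgApprox.Idx B (∅ : Finset B))ᵒᵖ → SchemeOver K := fun i => (SubalgApprox.baseDiagram K B ∅).obj i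
  let leg : ∀ i, TB ⟶ Ts i := fun i => (SubalgApprox.baseCone K B ∅).π.app i
  let P : ι → SchemeOver K := fun k => Resolution.ChowLemmaRing.projOver K (n k)
  let i₀ : (SubalgApprox.Idx B (∅ : Finset B))ᵒᵖ := op ⟨∅, Finset.Subset.refl _⟩
  -- the closed sets `𝒲_k ⊆ (ℙ_k ⊗ Spec B).left`
  let ρB : ∀ k, (N k ⊗ TB).left ⟶ (M ⊗ TB).left := fun k => (ρ k ▷ TB).left
  let eB : ∀ k, (N k ⊗ TB).left ⟶ (P k ⊗ TB).left := fun k => (e k ▷ TB).left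
  let wN : ∀ k, pullback jY (ρB k) ⟶ (N k ⊗ TB).left := fun k => pullback.snd jY (ρB k)
  let 𝒲 : ∀ k, Set ↥(P k ⊗ TB).left := fun k => Set.range (wN k ≫ eB k)
  haveI : ∀ k, IsProper (ρB k) := fun k => isProper_whiskerRight_left (ρ k) TB
  haveI : ∀ k, IsImmersion (eB k) := fun k => isImmersion_whiskerRight_left (e k) TB
  haveI : ∀ k, IsImmersion (e k ▷ Ts i₀).left := fun k => isImmersion_whiskerRight_left (e k) (Ts i₀)
  have h𝒲closed : ∀ k, IsClosed (𝒲 k) := fun k => by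
    -- `W_k → ℙ_{k,B}` is proper: its composite with `ℙ_{k,B} → Spec B` is `W_k → Y → Spec B`
    have hc : (wN k ≫ eB k) ≫ pullback.snd (P k).hom TB.hom =
        pullback.fst jY (ρB k) ≫ jY ≫ pullback.snd M.hom TB.hom := by
      rw [Category.assoc, Over.whiskerRight_left_snd, ← Over.whiskerRight_left_snd (ρ k),
        ← Category.assoc, ← pullback.condition, Category.assoc]
    haveI : IsProper (pullback.fst jY (ρB k) ≫ jY ≫ pullback.snd M.hom TB.hom) := inferInstance
    haveI : IsProper ((wN k ≫ eB k) ≫ pullback.snd (P k).hom TB.hom) := by rw [hc]; infer_instance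
    haveI : IsProper (wN k ≫ eB k) := IsProper.of_comp _ (pullback.snd (P k).hom TB.hom)
    exact (wN k ≫ eB k).isClosedMap.isClosed_range
  -- `𝒲_k` lies over the coborder of the image of `e_{k,t₀}`
  have h𝒲U : ∀ k, 𝒲 k ⊆ (SubalgApprox.prodCone K B ∅ (P k)).π.app i₀ ⁻¹'
      ((e k ▷ Ts i₀).left.coborderRange : Set ↥(P k ⊗ Ts i₀).left) := by
    intro k
    rintro _ ⟨w, rfl⟩
    refine subset_coborder ⟨(N k ◁ leg i₀).left (wN k w), ?_⟩
    change _ = ((wN k ≫ eB k) ≫ (P k ◁ leg i₀).left) w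
    rw [Category.assoc, whiskerRight_left_whiskerLeft_left (e k) (leg i₀), Scheme.Hom.comp_apply,
      Scheme.Hom.comp_apply]
  -- eventually the closures of the images lie over these coborders
  have hev : ∀ k, ∃ (i₁ : (SubalgApprox.Idx B (∅ : Finset B))ᵒᵖ) (f₁ : i₁ ⟶ i₀),
      ∀ (j : (SubalgApprox.Idx B (∅ : Finset B))ᵒᵖ) (fj : j ⟶ i₁),
        closure ((SubalgApprox.prodCone K B ∅ (P k)).π.app j '' 𝒲 k) ⊆
          (SubalgApprox.prodDiagram K B ∅ (P k)).map (fj ≫ f₁) ⁻¹'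
            ((e k ▷ Ts i₀).left.coborderRange : Set ↥(P k ⊗ Ts i₀).left) := fun k =>
    exists_closure_image_subset_preimage (SubalgApprox.prodDiagram K B ∅ (P k))
      (SubalgApprox.prodCone K B ∅ (P k)) (SubalgApprox.isLimitProdCone K B ∅ (P k))
      ((e k ▷ Ts i₀).left.coborderRange) (h𝒲closed k) (h𝒲U k)
  choose i₁ f₁ H using hev
  obtain ⟨i₂, hi₂⟩ := SubalgApprox.exists_hom_of_finite (B := B) (s₁ := (∅ : Finset B)) i₁
  refine ⟨i₂, fun j φ => ?_⟩
  -- ### at the stage `j`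
  let Tj := Ts j
  let πM : (M ⊗ TB).left ⟶ (M ⊗ Tj).left := (M ◁ leg j).left
  let πN : ∀ k, (N k ⊗ TB).left ⟶ (N k ⊗ Tj).left := fun k => (N k ◁ leg j).left
  let πP : ∀ k, (P k ⊗ TB).left ⟶ (P k ⊗ Tj).left := fun k => (P k ◁ leg j).left
  let ej : ∀ k, (N k ⊗ Tj).left ⟶ (P k ⊗ Tj).left := fun k => (e k ▷ Tj).left
  let ρj : ∀ k, (N k ⊗ Tj).left ⟶ (M ⊗ Tj).left := fun k => (ρ k ▷ Tj).left
  haveI : ∀ k, IsProper (ρj k) := fun k => isProper_whiskerRight_left (ρ k) Tj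
  haveI : ∀ k, IsImmersion (ej k) := fun k => isImmersion_whiskerRight_left (e k) Tj
  -- the closed sets `F_k = cl π(𝒲_k) ∩ range e_{k,j}`
  let F : ∀ k, Set ↥(P k ⊗ Tj).left := fun k => closure (πP k '' 𝒲 k) ∩ Set.range (ej k)
  have hFclosed : ∀ k, IsClosed (F k) := fun k => by
    refine isClosed_inter_of_subset_coborder isClosed_closure ?_
    have h1 := H k j (φ ≫ (hi₂ k).some)
    have h2 : (SubalgApprox.prodDiagram K B ∅ (P k)).map ((φ ≫ (hi₂ k).some) ≫ f₁ k) ⁻¹'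
        ((e k ▷ Ts i₀).left.coborderRange : Set ↥(P k ⊗ Ts i₀).left) ⊆ coborder (Set.range (ej k)) := by
      refine (Continuous.preimage_coborder_subset (Scheme.Hom.continuous _) _).trans (subset_of_eq ?_)
      rw [range_whiskerRight_left (e k) ((SubalgApprox.baseDiagram K B ∅).map ((φ ≫ (hi₂ k).some) ≫ f₁ k))]
      rfl
    exact h1.trans h2
  -- the proper pieces `W''_k → (M ⊗ Spec K[t]).left`
  let s' : ∀ k, (vanishingIdeal ⟨F k, hFclosed k⟩).subscheme ⟶ (P k ⊗ Tj).left := fun k =>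
    (vanishingIdeal ⟨F k, hFclosed k⟩).subschemeι
  have hs'range : ∀ k, Set.range (s' k) = F k := fun k => by
    rw [range_subschemeι, coe_support_vanishingIdeal]; rfl
  let σ : ∀ k, pullback (s' k) (ej k) ⟶ (M ⊗ Tj).left := fun k => pullback.snd (s' k) (ej k) ≫ ρj k
  have hσproper : ∀ k, IsProper (σ k ≫ pullback.snd M.hom Tj.hom) := fun k => by
    -- `W'' → W'` is a closed immersion: an immersion (base change of `e_{k,j}`) which is onto
    haveI : IsClosedImmersion (pullback.fst (s' k) (ej k)) := by
      refine IsClosedImmersion.of_isPreimmersion _ ?_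
      rw [Scheme.Pullback.range_fst]
      have huniv : (s' k) ⁻¹' Set.range (ej k) = Set.univ :=
        Set.eq_univ_iff_forall.mpr fun p => ((hs'range k).le ⟨p, rfl⟩).2
      rw [huniv]
      exact isClosed_univ
    have hc : σ k ≫ pullback.snd M.hom Tj.hom = (pullback.fst (s' k) (ej k) ≫ s' k) ≫ pullback.snd (P k).hom Tj.hom := by
      rw [Category.assoc, Over.whiskerRight_left_snd, pullback.condition, Category.assoc,
        Over.whiskerRight_left_snd]
    rw [hc]
    infer_instance
  haveI hσ : ∀ k, IsProper (σ k) := fun k =>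
    haveI := hσproper k
    IsProper.of_comp _ (pullback.snd M.hom Tj.hom)
  -- ### the image of `Y` is covered by the images of the `W''_k`
  have hcovY : ∀ y : Y, ∃ k, (jY ≫ πM) y ∈ Set.range (σ k) := by
    intro y
    obtain ⟨k, v, hv⟩ := hcov (pullback.fst M.hom TB.hom (jY y))
    obtain ⟨m, hm⟩ := mem_range_whiskerRight_left (ρ k) TB (x := jY y) ⟨v, hv⟩
    obtain ⟨w, -, hw⟩ := Scheme.Pullback.exists_preimage_pullback (f := jY) (g := ρB k) y m hm.symm
    refine ⟨k, ?_⟩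
    -- `π^M (jY y) = ρ_j (π^N m)` and `π^N m ∈ range (W'' → N_j)`
    have h1 : (jY ≫ πM) y = ρj k (πN k m) := by
      rw [Scheme.Hom.comp_apply, ← hm]
      change ((ρ k ▷ TB).left ≫ (M ◁ leg j).left) m = ((N k ◁ leg j).left ≫ (ρ k ▷ Tj).left) m
      rw [whiskerRight_left_whiskerLeft_left]
    have h2 : πN k m ∈ Set.range (pullback.snd (s' k) (ej k)) := by
      rw [Scheme.Pullback.range_snd, hs'range]
      refine ⟨subset_closure ⟨eB k m, ⟨w, ?_⟩, ?_⟩, ⟨πN k m, rfl⟩⟩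
      · rw [Scheme.Hom.comp_apply, hw]
      · change ((e k ▷ TB).left ≫ (P k ◁ leg j).left) m = ((N k ◁ leg j).left ≫ (e k ▷ Tj).left) m
        rw [whiskerRight_left_whiskerLeft_left]
    obtain ⟨w'', hw''⟩ := h2
    exact ⟨w'', by rw [h1, ← hw'', ← Scheme.Hom.comp_apply]⟩
  -- ### the stage image is covered by the proper pieces
  let yι := (jY ≫ (SubalgApprox.prodCone K B ∅ M).π.app j).ker.subschemeι
  have hyι : Set.range yι ⊆ ⋃ k, Set.range (σ k) := by
    have hR : IsClosed (⋃ k, Set.range (σ k)) :=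
      isClosed_iUnion_of_finite fun k => (σ k).isClosedMap.isClosed_range
    change Set.range (jY ≫ (SubalgApprox.prodCone K B ∅ M).π.app j).ker.subschemeι ⊆ _
    rw [range_subschemeι, Scheme.Hom.support_ker]
    refine hR.closure_subset_iff.mpr ?_
    rintro _ ⟨y, rfl⟩
    exact Set.mem_iUnion.mpr (hcovY y)
  haveI : ∀ k, IsProper (pullback.fst yι (σ k) ≫ yι ≫ pullback.snd M.hom Tj.hom) := fun k => by
    rw [← Category.assoc, pullback.condition, Category.assoc]
    haveI := hσproper k
    infer_instance
  exact isProper_of_finite_cover (yι ≫ pullback.snd M.hom Tj.hom) (fun k => pullback.fst yι (σ k)) fun y' => by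
    obtain ⟨k, w'', hw''⟩ := Set.mem_iUnion.mp (hyι ⟨y', rfl⟩)
    obtain ⟨z, hz, -⟩ := Scheme.Pullback.exists_preimage_pullback (f := yι) (g := σ k) y' w'' hw''.symm
    exact ⟨k, z, hz⟩

end Main

end StageImages

end Literature.AlgebraicGeometry.Morphisms

end
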